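/-
Copyright (c) 2026 the pub-hodgecm-mathlib formalisation cell (harness21).  Prover seat hodgecm-mathlib-F0P3a-p02 (g23): LH4-plan (g7) WORD #18 «(C6)-4» — ROW 0
of the depth-zero κ-transfer read in the TRACE frame (CENSUS-C6-ReadersTrace 196c9bc3 §1 rows 4–5, LH3-p02 (g6)); consumer of this lineage's ★ MÖBIUS LITERAL
(p851753, (M5-β)); 2026-09-02.
-/
import Literature.NumberTheory.Rogawski1990.DepthZeroKappaTransferMoebiusLiteral          -- ★ p851753 (this lineage, (M5-β)): `exists_moebius_literal_of_congr_conj_diagonal` (+ ★ A1's cone)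
import Literature.NumberTheory.Rogawski1990.DepthZeroKappaTransferTypeOneUnitRowTrace      -- ★ p851796 (P3d): `exists_generalLinearGroup_diagPi`; ★ p851724 (T1)–(T5) `FlickerTorusTraceFrame`
import Literature.NumberTheory.Automorphic.UnitaryGroupBorelInduction                       -- ★ `conjLocal_conjLocal_cm`
import HarnessLib

/-!
# The depth-zero κ-transfer, type (1): ROW 0 per TRACE literal — `n₀(t_π^{(b)}(x)) = φ₁(Q₁ − 1, P − 1)`, `n₀(t_1^{(b)}(x)) = φ₀(Q₁ − 1, Q₂ − 1, P − 1)`,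
# at EVERY residue characteristic, modulo the inert count at the completion (Rogawski 1990 Prop. 4.9.1 (b); Kottwitz 1986 §3; Flicker 1998 Props. 11, 14)

Topic `NumberTheory/Rogawski1990`; namespace `Literature.NumberTheory.Rogawski1990`.  THEOREMS ONLY (no definition, no instance, no notation, no named fact,
no `sorry`); kernel lane `--supports stmt-HodgeConjecture-24833`.  Cell `pub/hodgecm-mathlib` (D-0151), crux H413; half A line LH4 (dyadic pay-down leaf
`Cruxes/H413/Lines/F0_P3c_DyadicPaydown.lean`, organ (D-UNR) PRINT by ruling D74′); LAYER C readers, file (C6)-4 of CENSUS-C6-ReadersTrace (LH3-p02 (g6),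
sha16 196c9bc3b64f0cb5 §1 rows 4–5; LH4-plan (g7) WORD #18): the trace-frame, `|2|`-free twin of ★ `DepthZeroKappaTransferTypeOneRowZero` (A-p12 (g21)).

WHAT.  ★ `…RowZero` reads `n₀(t)` — the residually trivial stratum of `Fix_t(G′_v ⧸ K_v)` in ★ O8b `classOrbitalIntegral_eq_mul_strata_three_of_deep` — for `t ∈ G′_v`
congruent (`ψ g = Tl g Tl⁻¹`) to FLICKER's literals `t_π(x₁,x₂,x₃)`, `t_1(x₁,x₂,x₃)` (frame `D_π h`, `2e = 1`, Gram `diag(−2π, 1, 2π)`), through the CAYLEY literal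
(`h2 : |2|_w = 1`) and Flicker's inert count engine (`h2 : 2 ∉ v`, corner frame `yσy = −2`).  Here the literals are the TRACE literals of ★ p851724 ∕ ★ p851796,

  `t_π^{(b)}(x₁,x₂,x₃) = !![x₁σb + x₃b, 0, π(x₁ − x₃); 0, x₂, 0; π′bσb(x₁ − x₃), 0, x₁b + x₃σb]`   (`b + σb = 1`, `ππ′ = 1`; `t_1^{(b)}` is `π = π′ = 1`),

whose eigenframe in the `Φ₃`-model is `F = diag(π,1,1)·Q_b`, `Q_b = !![1,0,1; 0,1,0; b,0,−σb]`, with `Φ₃`-Gram `diag(π, 1, −π)` (★ (T1) `twistGram_diag_mul_traceFrame`;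
`diag(1,1,−1)` at `π = 1`, ★ `twistGram_traceFrame`) — exactly the `hG` binder of this lineage's ★ MÖBIUS LITERAL `exists_moebius_literal_of_congr_conj_diagonal`
(the `h2`-free level shift: norm-one `Y_i`, distances LOWERED BY ONE, `t′` congruent to `F·diag(Y)·F⁻¹`, `n₀(t) = #Fix_{t′_w}(U_w ⧸ unitaryInt)`), and `F·diag(Y)·F⁻¹`
is AGAIN a trace literal `t_π^{(b)}(Y₁,Y₂,Y₃)` (★ (T3)(T5)).  So `n₀(t)` is the θ̄ = 1 (resp. θ̄ = 0) INERT COUNT at the completion `L_w` of the trace literal at the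
exponents `(P − 1, Q₁ − 1, Q₂ − 1)` — which this file takes as the HYPOTHESIS `hX₁` (resp. `hX₀`), spelled as the (C5)′ EXPORT head
`natCard_fixedPoints_unitaryInt_traceTorusPi_eq_phiOne_adicCompletion` (resp. `…_traceTorus_eq_phiZero_adicCompletion`) of CENSUS-C5 bd72510a §3 + ruling T7
(`hbδ : |σb − b|_w = 1`), fixed at `(L, w)`: the two exports are the end of the 12-file (C5)′ chain (LH3-p02's §6) and are not ★ yet; when they land, the closed heads
`ncard_rankStratum_zero_eq_phiOne_of_congr_traceTorusEltPi` ∕ `…_eq_phiZero_of_congr_traceTorusElt` are the one-line instantiations `… (hX₁ := fun … =>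
natCard_fixedPoints_unitaryInt_traceTorusPi_eq_phiOne_adicCompletion L w hw …)` (a 30-line sequel, this lineage's pen) — the (C6)-6 `…CountsTrace` ROW-0 conjuncts.

* **`ncard_rankStratum_zero_eq_phiOne_of_congr_traceTorusEltPi_of_count`** (θ̄ = 1): binders = ★ `ncard_rankStratum_zero_eq_phiOne_of_congr` with `h2 {e y} h2e hy`
  DELETED, `{b} (hb) (hbv) (hbδ)` ADDED (and `hX₁`); literal = ★ p851796 :93 = ★ p851882 `hCPi` token; conclusion `φ₁(q_v; Q₁ − 1, P − 1)` VERBATIM.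
* **`ncard_rankStratum_zero_eq_phiZero_of_congr_traceTorusElt_of_count`** (θ̄ = 0): the same surgery on ★ `ncard_rankStratum_zero_eq_phiZero_of_congr` (and `hX₀`);
  literal = ★ p851796 :223 = ★ p851882 `hCOne` token; conclusion `φ₀(q_v; Q₁ − 1, Q₂ − 1, P − 1)` VERBATIM (trichotomy transported by `omega`, as ★).
NOTE for (C6)-6 ∕ `…GSideTraceClosed` (F0P3a-p08): ★ p851882's `hCOne`∕`hCPi` carry `hb` only; the inert count needs `|b|_w ≤ 1` and T7 `|σb − b|_w = 1` as well
(any `b` from ★ `UnramifiedLocalConjDatum.trace` at a dyadic `w` has both: `|1 − 2b| = 1`), so the discharge must source `hbv`, `hbδ` with `b`.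
HONEST LABEL: HC_CM is proved only modulo the 7 printed citations (2 remaining: hLiu418 = stmt-HodgeConjecture-24832, h413 = stmt-HodgeConjecture-24833) until rung 0
closes; count-neutral ((D-UNR) stays PRINT by D74′); pays no organ, opens no road.

## References
* [Rogawski1990] J. D. Rogawski, *Automorphic Representations of Unitary Groups in Three Variables* (1990), §4.9 p. 54, Prop. 4.9.1 (b) p. 55.
* [Kottwitz1986] R. E. Kottwitz, *Base change for unit elements of Hecke algebras*, Compositio Math. 60 (1986), §3 (the level recursion, all residue characteristics).
* [Flicker1998UnitaryFL] Y. Z. Flicker, *Elementary proof of the fundamental lemma for a unitary group*, Canad. J. Math. 50 (1998), §2 Prop. 3 pp. 78–79, Prop. 11 p. 87,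
  Prop. 14 p. 94.
* [Jacobowitz1962] R. Jacobowitz, *Hermitian forms over local fields*, Amer. J. Math. 84 (1962), §7 Thm. 7.1 (the trace condition `b + b̄ = 1`).
-/

set_option autoImplicit false

noncomputable section

open MeasureTheory Measure Set Function NumberField IsDedekindDomain Matrix Polynomial
open Literature.NumberTheory.Automorphic Literature.NumberTheory.Automorphic.UnitaryGroup
open Literature.NumberTheory.Automorphic.IntegralReduction Literature.NumberTheory.GaloisRepresentations
open Literature.NumberTheory.Automorphic.HermitianLattice (unitaryInt)
open scoped Matrix MatrixGroups ValuativeRel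

namespace Literature.NumberTheory.Rogawski1990

/-! ## §1 The trace literal is the conjugate of `diag` by its explicit frame (★ (T3)(T5) packaged on a `GL₃` certificate) -/

section Ring

variable {R : Type*} [CommRing R] (σ : R →+* R)

/-- `t_π^{(b)}(a,m,c) = F·diag(a,m,c)·F⁻¹` for any `F ∈ GL₃` with `F = diag(π,1,1)·Q_b` (`b + σb = 1`, `ππ′ = 1`): ★ (T5) `diag_mul_traceTorusElt` then ★ (T3)
`traceTorusElt_mul_frame`. [cite: Flicker1998UnitaryFL, §2 Prop. 3 pp. 78–79] -/
theorem traceTorusEltPi_eq_conj_diagonal_of_frame {b : R} (hb : b + σ b = 1) {π π' : R} (hππ : π * π' = 1) (F : GL (Fin 3) R)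
    (hF : F.val = !![π, 0, 0; 0, 1, 0; 0, 0, 1] * !![(1 : R), 0, 1; 0, 1, 0; b, 0, -σ b]) (a m c : R) :
    !![a * σ b + c * b, 0, π * (a - c); 0, m, 0; π' * (b * σ b * (a - c)), 0, a * b + c * σ b] = F.val * diagonal ![a, m, c] * (F⁻¹).val := by
  have hframe : !![a * σ b + c * b, 0, π * (a - c); 0, m, 0; π' * (b * σ b * (a - c)), 0, a * b + c * σ b] * F.val = F.val * diagonal ![a, m, c] := by
    rw [hF, Flicker1998.diagonal_fin_three, ← Matrix.mul_assoc, ← diag_mul_traceTorusElt σ hππ b a m c, Matrix.mul_assoc,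
      traceTorusElt_mul_frame σ hb a m c, Matrix.mul_assoc]
  rw [← hframe, Matrix.mul_assoc, ← Units.val_mul, mul_inv_cancel, Units.val_one, Matrix.mul_one]

/-- `t_1^{(b)}(a,m,c) = Q·diag(a,m,c)·Q⁻¹` for any `Q ∈ GL₃` with `Q = Q_b` (`b + σb = 1`): ★ (T3) `traceTorusElt_mul_frame`. [cite: Flicker1998UnitaryFL, §2 Prop. 3 pp. 78–79] -/
theorem traceTorusElt_eq_conj_diagonal_of_frame {b : R} (hb : b + σ b = 1) (Q : GL (Fin 3) R)
    (hQ : Q.val = !![(1 : R), 0, 1; 0, 1, 0; b, 0, -σ b]) (a m c : R) :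
    !![a * σ b + c * b, 0, a - c; 0, m, 0; b * σ b * (a - c), 0, a * b + c * σ b] = Q.val * diagonal ![a, m, c] * (Q⁻¹).val := by
  have hframe : !![a * σ b + c * b, 0, a - c; 0, m, 0; b * σ b * (a - c), 0, a * b + c * σ b] * Q.val = Q.val * diagonal ![a, m, c] := by
    rw [hQ, Flicker1998.diagonal_fin_three, traceTorusElt_mul_frame σ hb a m c]
  rw [← hframe, Matrix.mul_assoc, ← Units.val_mul, mul_inv_cancel, Units.val_one, Matrix.mul_one]

/-- The `Φ₃`-Gram matrix of a frame `F = diag(π,1,1)·Q_b` (`σσ = id`, `b + σb = 1`, `σπ = π`) is `diagonal ![π, 1, −π]` — ★ (T1) `twistGram_diag_mul_traceFrame` in the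
`(Fᵀσ)·Φ₃·F = diagonal d` shape of ★ `exists_moebius_literal_of_congr_conj_diagonal`'s binder `hG`. [cite: Jacobowitz1962, §7 Thm. 7.1] [cite: Flicker1998UnitaryFL, §2 Prop. 3 p. 79] -/
theorem gram_eq_diagonal_of_traceFramePi (hσσ : ∀ x, σ (σ x) = x) {b : R} (hb : b + σ b = 1) {π : R} (hσπ : σ π = π) (F : GL (Fin 3) R)
    (hF : F.val = !![π, 0, 0; 0, 1, 0; 0, 0, 1] * !![(1 : R), 0, 1; 0, 1, 0; b, 0, -σ b]) :
    ((F.val : Matrix (Fin 3) (Fin 3) R).map σ)ᵀ * (Matrix.of fun i j : Fin 3 => if i.val + j.val + 1 = 3 then (1 : R) else 0) * F.val = diagonal ![π, 1, -π] := by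
  rw [hF, Flicker1998.diagonal_fin_three, ← twistGram_def]
  exact twistGram_diag_mul_traceFrame σ hσσ hb hσπ

/-- The `Φ₃`-Gram matrix of the frame `Q_b` (`σσ = id`, `b + σb = 1`) is `diagonal ![1, 1, −1]` — ★ (T1) `twistGram_traceFrame`. [cite: Jacobowitz1962, §4 (4.2)–(4.4)] -/
theorem gram_eq_diagonal_of_traceFrame (hσσ : ∀ x, σ (σ x) = x) {b : R} (hb : b + σ b = 1) (Q : GL (Fin 3) R)
    (hQ : Q.val = !![(1 : R), 0, 1; 0, 1, 0; b, 0, -σ b]) :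
    ((Q.val : Matrix (Fin 3) (Fin 3) R).map σ)ᵀ * (Matrix.of fun i j : Fin 3 => if i.val + j.val + 1 = 3 then (1 : R) else 0) * Q.val = diagonal ![(1 : R), 1, -1] := by
  rw [hQ, Flicker1998.diagonal_fin_three, ← twistGram_def]
  exact twistGram_traceFrame σ hσσ hb

end Ring

/-! ## §2 The heads: ROW 0 at the θ̄ = 1 trace literals `t_π^{(b)}` and at the θ̄ = 0 trace literal `t_1^{(b)}`, modulo the inert count at `L_w` -/

section Heads

variable (L : Type) [Field L] [NumberField L] [IsCMField L] (H' : Matrix (Fin 3) (Fin 3) L)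
  {v : HeightOneSpectrum (𝓞 ↥(maximalRealSubfield L))}

set_option synthInstance.maxHeartbeats 200000 in  -- the coset action `U_w ↷ U_w ⧸ unitaryInt` (as in ★ `FixedCosetsTransport`)
set_option maxHeartbeats 400000 in  -- the heavy one-place carriers
open scoped Classical in
/-- **ROW 0 AT A θ̄ = 1 TRACE LITERAL, EVERY RESIDUE CHARACTERISTIC (measure-free; modulo the inert count `hX₁` at `L_w`)**: for `t ∈ G′_v` congruent to
`t_π^{(b)}(x₁,x₂,x₃)` (`b + σb = 1`, `|b|_w ≤ 1`, `|σb − b|_w = 1`; `x_i` pairwise distinct of norm one and ≡ 1 (mod 𝔪_w); `P = ord_w(x₁ − x₃)`, `Q₁ = ord_w(x₁ − x₂)`)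
at an inert UNRAMIFIED `v` — `v ∣ 2` allowed — the residually trivial stratum of `Fix_t(G′_v ⧸ K_v)` has **`n₀(t) = φ₁(Q₁ − 1, P − 1)`**, GIVEN the θ̄ = 1 inert count
`hX₁` at `L_w` for trace literals (the (C5)′ export `natCard_fixedPoints_unitaryInt_traceTorusPi_eq_phiOne_adicCompletion`, CENSUS-C5 §3 + T7, at `(L, w)`): the MÖBIUS
literal `t′` of ★ `exists_moebius_literal_of_congr_conj_diagonal` (frame `diag(π,1,1)·Q_b`, Gram `diag(π,1,−π)`) is again a `t_π^{(b)}`-literal, at the exponents lowered by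
one.  Twin of ★ `ncard_rankStratum_zero_eq_phiOne_of_congr` with `h2 {e y} h2e hy` DELETED, `{b} (hb) (hbv) (hbδ)` + `hX₁` ADDED.
[cite: Rogawski1990, §4.9 p. 54, Prop. 4.9.1 (b) p. 55] [cite: Kottwitz1986, §3] [cite: Flicker1998UnitaryFL, Prop. 11 p. 87] -/
theorem ncard_rankStratum_zero_eq_phiOne_of_congr_traceTorusEltPi_of_count
    (hH' : (H'.map (IsCMField.complexConj L))ᵀ = H') (hH'u : IsUnit H') (w : PlacesOver L v)
    (hw : IsCMField.complexConj L • w.1 = w.1) (hv : Algebra.IsUnramifiedIn (𝓞 L) v.asIdeal)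
    {b π π' x₁ x₂ x₃ : LocalRing L v} (hb : b + conjLocal L (IsCMField.complexConj L) v b = 1)
    (hbv : Valued.v (b w) ≤ 1) (hbδ : Valued.v ((conjLocal L (IsCMField.complexConj L) v b - b) w) = 1)
    (hσπ : conjLocal L (IsCMField.complexConj L) v π = π) (hππ : π * π' = 1)
    (hπN : ∀ z : LocalRing L v, conjLocal L (IsCMField.complexConj L) v z * z ≠ π)
    (hx₁ : conjLocal L (IsCMField.complexConj L) v x₁ * x₁ = 1) (hx₂ : conjLocal L (IsCMField.complexConj L) v x₂ * x₂ = 1)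
    (hx₃ : conjLocal L (IsCMField.complexConj L) v x₃ * x₃ = 1) (h₁₂ : x₁ ≠ x₂) (h₂₃ : x₂ ≠ x₃) (h₁₃ : x₁ ≠ x₃)
    (Tl : GL (Fin 3) (LocalRing L v))
    (ψ : ↥(UnitaryGroup.«local» L (IsCMField.complexConj L) 3 H' v) ≃ₜ*
        ↥(UnitaryGroup.«local» L (IsCMField.complexConj L) 3 (Matrix.of fun i j : Fin 3 => if i.val + j.val + 1 = 3 then (1 : L) else 0) v))
    (t : (cmDatum L 3 H').Local v)
    (hψ : ∀ g, (ψ g).val = Tl * g.val * Tl⁻¹)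
    (hlev : ∀ g, g ∈ cmLocalIntegralLevel L 3 H' v ↔
        ψ g ∈ cmLocalIntegralLevel L 3 (Matrix.of fun i j : Fin 3 => if i.val + j.val + 1 = 3 then (1 : L) else 0) v)
    (hlit : (ψ t).val.val =
          !![x₁ * conjLocal L (IsCMField.complexConj L) v b + x₃ * b, 0, π * (x₁ - x₃); 0, x₂, 0;
            π' * (b * conjLocal L (IsCMField.complexConj L) v b * (x₁ - x₃)), 0, x₁ * b + x₃ * conjLocal L (IsCMField.complexConj L) v b])
    {P Q₁ Q₂ : ℕ} (hP : Valued.v (x₁ w - x₃ w) = WithZero.exp (-(P : ℤ))) (hQ₁ : Valued.v (x₁ w - x₂ w) = WithZero.exp (-(Q₁ : ℤ)))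
    (hQ₂ : Valued.v (x₃ w - x₂ w) = WithZero.exp (-(Q₂ : ℤ)))
    (hd₁ : Valued.v (x₁ w - 1) < 1) (hd₂ : Valued.v (x₂ w - 1) < 1) (hd₃ : Valued.v (x₃ w - 1) < 1)
    -- the θ̄ = 1 INERT COUNT at `L_w` for trace literals: the (C5)′ export head's text at `(L, w)` (CENSUS-C5 bd72510a §3 + T7), a hypothesis until it lands
    (hX₁ : ∀ {b : w.1.adicCompletion L}, b + galAdicCompletionMap (L := L) (IsCMField.complexConj L) hw b = 1 → Valued.v b ≤ 1 →
      Valued.v (galAdicCompletionMap (L := L) (IsCMField.complexConj L) hw b - b) = 1 →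
      ∀ {x₁ x₂ x₃ π π' : w.1.adicCompletion L}, galAdicCompletionMap (L := L) (IsCMField.complexConj L) hw x₁ * x₁ = 1 →
      galAdicCompletionMap (L := L) (IsCMField.complexConj L) hw x₂ * x₂ = 1 → galAdicCompletionMap (L := L) (IsCMField.complexConj L) hw x₃ * x₃ = 1 →
      galAdicCompletionMap (L := L) (IsCMField.complexConj L) hw π = π → π * π' = 1 →
      (∀ z : w.1.adicCompletion L, galAdicCompletionMap (L := L) (IsCMField.complexConj L) hw z * z ≠ π) →
      ∀ {t : ↥(unitaryGroupOfForm (galAdicCompletionMap (L := L) (IsCMField.complexConj L) hw)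
        (placeForm (Matrix.of fun i j : Fin 3 => if i.val + j.val + 1 = 3 then (1 : L) else 0) w.1))},
      ((t : GL (Fin 3) (w.1.adicCompletion L)) : Matrix (Fin 3) (Fin 3) (w.1.adicCompletion L)) =
        !![x₁ * galAdicCompletionMap (L := L) (IsCMField.complexConj L) hw b + x₃ * b, 0, π * (x₁ - x₃); 0, x₂, 0;
          π' * (b * galAdicCompletionMap (L := L) (IsCMField.complexConj L) hw b * (x₁ - x₃)), 0, x₁ * b + x₃ * galAdicCompletionMap (L := L) (IsCMField.complexConj L) hw b] →
      ∀ {N N₁ N₂ : ℕ}, Valued.v (x₁ - x₃) = WithZero.exp (-(N : ℤ)) → Valued.v (x₁ - x₂) = WithZero.exp (-(N₁ : ℤ)) →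
      Valued.v (x₃ - x₂) = WithZero.exp (-(N₂ : ℤ)) →
      {x : ↥(unitaryGroupOfForm (galAdicCompletionMap (L := L) (IsCMField.complexConj L) hw)
          (placeForm (Matrix.of fun i j : Fin 3 => if i.val + j.val + 1 = 3 then (1 : L) else 0) w.1)) ⧸
        unitaryInt (galAdicCompletionMap (L := L) (IsCMField.complexConj L) hw)
          (placeForm (Matrix.of fun i j : Fin 3 => if i.val + j.val + 1 = 3 then (1 : L) else 0) w.1) | t • x = x}.Finite →
      (Nat.card {x : ↥(unitaryGroupOfForm (galAdicCompletionMap (L := L) (IsCMField.complexConj L) hw)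
          (placeForm (Matrix.of fun i j : Fin 3 => if i.val + j.val + 1 = 3 then (1 : L) else 0) w.1)) ⧸
        unitaryInt (galAdicCompletionMap (L := L) (IsCMField.complexConj L) hw)
          (placeForm (Matrix.of fun i j : Fin 3 => if i.val + j.val + 1 = 3 then (1 : L) else 0) w.1) | t • x = x} : ℚ) =
        Flicker1998.phiOne (Ideal.absNorm v.asIdeal) N₁ N) :
    (({q : (cmDatum L 3 H').Local v ⧸ cmLocalIntegralLevel L 3 H' v |
        q ∈ MulAction.fixedBy ((cmDatum L 3 H').Local v ⧸ cmLocalIntegralLevel L 3 H' v) t ∧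
          (redMat ((((q.out⁻¹ * t * q.out : (cmDatum L 3 H').Local v)).val : GL (Fin 3) (LocalRing L v)).val.map
            (Pi.evalRingHom (fun w' : PlacesOver L v => w'.1.adicCompletion L) w)) - 1).rank = 0}.ncard : ℕ) : ℚ) =
      Flicker1998.phiOne (Ideal.absNorm v.asIdeal) (Q₁ - 1) (P - 1) := by
  have hc1 : IsCMField.complexConj L ≠ 1 := IsCMField.complexConj_ne_one L
  haveI : IsAdicComplete (IsLocalRing.maximalIdeal (Valued.integer (w.1.adicCompletion L))) (Valued.integer (w.1.adicCompletion L)) :=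
    isAdicComplete_maximalIdeal_valuedInteger_adicCompletion L w.1
  haveI : Algebra.IsQuadraticExtension ↥(maximalRealSubfield L) L := IsCMField.isQuadraticExtension L
  -- silence the unused distinctness binders (kept VERBATIM from ★ the unit row; the Möbius eigenvalues are separated by `hP hQ₁ hQ₂`)
  have _h : x₁ ≠ x₂ ∧ x₂ ≠ x₃ ∧ x₁ ≠ x₃ := ⟨h₁₂, h₂₃, h₁₃⟩
  have hσσ : ∀ z : LocalRing L v, conjLocal L (IsCMField.complexConj L) v (conjLocal L (IsCMField.complexConj L) v z) = z :=
    fun z => conjLocal_conjLocal_cm L v z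
  -- the trace frame `F = diag(π,1,1)·Q_b` in the `Φ₃`-model and its Gram matrix `diag(π, 1, −π)`
  obtain ⟨Qb, hQb, -⟩ := exists_generalLinearGroup_traceFrame (conjLocal L (IsCMField.complexConj L) v) hb
  obtain ⟨D, hD, -⟩ := exists_generalLinearGroup_diagPi (R := LocalRing L v) hππ
  obtain ⟨P₁, hP₁⟩ : ∃ P₁ : GL (Fin 3) (LocalRing L v), P₁.val = !![π, 0, 0; 0, 1, 0; 0, 0, 1] *
      !![(1 : LocalRing L v), 0, 1; 0, 1, 0; b, 0, -conjLocal L (IsCMField.complexConj L) v b] :=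
    ⟨D * Qb, by rw [Units.val_mul, hD, hQb]⟩
  have hG := gram_eq_diagonal_of_traceFramePi (conjLocal L (IsCMField.complexConj L) v) hσσ hb hσπ P₁ hP₁
  have hlitP : (ψ t).val.val = P₁.val * diagonal ![x₁, x₂, x₃] * (P₁⁻¹).val := by
    rw [hlit]; exact traceTorusEltPi_eq_conj_diagonal_of_frame (conjLocal L (IsCMField.complexConj L) v) hb hππ P₁ hP₁ x₁ x₂ x₃
  obtain ⟨Y₁, Y₂, Y₃, t', hlit', hY₁, hY₂, hY₃, hP', hQ₁', hQ₂', hfin, hn₀⟩ :=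
    exists_moebius_literal_of_congr_conj_diagonal L H' hH' hH'u w hw hv hx₁ hx₂ hx₃ Tl ψ t hψ hlev P₁ hG hlitP hP hQ₁ hQ₂ hd₁ hd₂ hd₃
  -- the Möbius literal IS a `t_π^{(b)}`-literal, read at `w`
  have hlit'' : (ψ t').val.val =
      !![Y₁ * conjLocal L (IsCMField.complexConj L) v b + Y₃ * b, 0, π * (Y₁ - Y₃); 0, Y₂, 0;
        π' * (b * conjLocal L (IsCMField.complexConj L) v b * (Y₁ - Y₃)), 0, Y₁ * b + Y₃ * conjLocal L (IsCMField.complexConj L) v b] := by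
    rw [hlit', traceTorusEltPi_eq_conj_diagonal_of_frame (conjLocal L (IsCMField.complexConj L) v) hb hππ P₁ hP₁ Y₁ Y₂ Y₃]
  have hσw : ∀ z : LocalRing L v, conjLocal L (IsCMField.complexConj L) v z w = galAdicCompletionMap (L := L) (IsCMField.complexConj L) hw (z w) :=
    fun z => conjLocal_apply_eq_of_smul_eq (IsCMField.complexConj L) hc1 v w hw z
  have hte : (((localNonsplitEquiv (IsCMField.complexConj L) (Matrix.of fun i j : Fin 3 => if i.val + j.val + 1 = 3 then (1 : L) else 0) hc1 w hw (ψ t') :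
        unitaryGroupOfForm (galAdicCompletionMap (L := L) (IsCMField.complexConj L) hw)
          (placeForm (Matrix.of fun i j : Fin 3 => if i.val + j.val + 1 = 3 then (1 : L) else 0) w.1)) :
        GL (Fin 3) (w.1.adicCompletion L)) : Matrix (Fin 3) (Fin 3) (w.1.adicCompletion L)) =
      !![Y₁ w * conjLocal L (IsCMField.complexConj L) v b w + Y₃ w * b w, 0, π w * (Y₁ w - Y₃ w); 0, Y₂ w, 0;
        π' w * (b w * conjLocal L (IsCMField.complexConj L) v b w * (Y₁ w - Y₃ w)), 0, Y₁ w * b w + Y₃ w * conjLocal L (IsCMField.complexConj L) v b w] := by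
    rw [coe_coe_localNonsplitEquiv_apply, hlit'']
    ext i j
    fin_cases i <;> fin_cases j <;> rfl
  rw [hσw b] at hte
  -- the data at `w`
  have hbw : b w + galAdicCompletionMap (L := L) (IsCMField.complexConj L) hw (b w) = 1 := by
    have h := congrFun hb w
    rw [Pi.add_apply, hσw, Pi.one_apply] at h
    exact h
  have hbδw : Valued.v (galAdicCompletionMap (L := L) (IsCMField.complexConj L) hw (b w) - b w) = 1 := by
    have h := hbδ
    rw [Pi.sub_apply, hσw] at h
    exact h
  have hσπw : galAdicCompletionMap (L := L) (IsCMField.complexConj L) hw (π w) = π w := by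
    rw [← hσw]; exact (congrFun hσπ w : _)
  have hππw : π w * π' w = 1 := by
    have := congrFun hππ w; simpa using this
  have hπNw : ∀ z : w.1.adicCompletion L, galAdicCompletionMap (L := L) (IsCMField.complexConj L) hw z * z ≠ π w := by
    intro z hz
    haveI : Subsingleton (PlacesOver L v) := PlacesOver.subsingleton_of_smul_eq (IsCMField.complexConj L) hc1 w hw
    letI : Unique (PlacesOver L v) := uniqueOfSubsingleton w
    let πe : LocalRing L v ≃+* w.1.adicCompletion L := RingEquiv.piUnique fun w' : PlacesOver L v => w'.1.adicCompletion L
    have hz' : πe.symm z w = z := πe.apply_symm_apply z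
    refine hπN (πe.symm z) (πe.injective ?_)
    show (conjLocal L (IsCMField.complexConj L) v (πe.symm z) * πe.symm z) w = π w
    rw [Pi.mul_apply, hσw, hz', hz]
  rw [hn₀]
  exact hX₁ hbw hbv hbδw hY₁ hY₂ hY₃ hσπw hππw hπNw hte hP' hQ₁' hQ₂' hfin

set_option synthInstance.maxHeartbeats 200000 in  -- the coset action `U_w ↷ U_w ⧸ unitaryInt` (as in ★ `FixedCosetsTransport`)
set_option maxHeartbeats 400000 in  -- the heavy one-place carriers
open scoped Classical in
/-- **ROW 0 AT THE θ̄ = 0 TRACE LITERAL, EVERY RESIDUE CHARACTERISTIC (measure-free; modulo the inert count `hX₀` at `L_w`)**: for `t ∈ G′_v` congruent to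
`t_1^{(b)}(x₁,x₂,x₃)` (`b + σb = 1`, `|b|_w ≤ 1`, `|σb − b|_w = 1`; `x_i` pairwise distinct of norm one and ≡ 1 (mod 𝔪_w); exponents `P, Q₁, Q₂`, two equal and not
exceeding the third) at an inert UNRAMIFIED `v` — `v ∣ 2` allowed —: **`n₀(t) = φ₀(Q₁ − 1, Q₂ − 1, P − 1)`**, GIVEN the θ̄ = 0 inert count `hX₀` at `L_w` for trace
literals (the (C5)′ export `natCard_fixedPoints_unitaryInt_traceTorus_eq_phiZero_adicCompletion`, CENSUS-C5 §3 + T7, at `(L, w)`): the MÖBIUS literal with the frame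
`Q_b` (Gram `diag(1,1,−1)`, ★ (T1)) is again a `t_1^{(b)}`-literal, exponents lowered by one, trichotomy transported (`1 ≤ P, Q₁, Q₂` from `hd₁ hd₂ hd₃`).  Twin of ★
`ncard_rankStratum_zero_eq_phiZero_of_congr` with `h2 {e y} h2e hy` DELETED, `{b} (hb) (hbv) (hbδ)` + `hX₀` ADDED.
[cite: Rogawski1990, §4.9 p. 54, Prop. 4.9.1 (b) p. 55] [cite: Kottwitz1986, §3] [cite: Flicker1998UnitaryFL, Prop. 14 p. 94] -/
theorem ncard_rankStratum_zero_eq_phiZero_of_congr_traceTorusElt_of_count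
    (hH' : (H'.map (IsCMField.complexConj L))ᵀ = H') (hH'u : IsUnit H') (w : PlacesOver L v)
    (hw : IsCMField.complexConj L • w.1 = w.1) (hv : Algebra.IsUnramifiedIn (𝓞 L) v.asIdeal)
    {b x₁ x₂ x₃ : LocalRing L v} (hb : b + conjLocal L (IsCMField.complexConj L) v b = 1)
    (hbv : Valued.v (b w) ≤ 1) (hbδ : Valued.v ((conjLocal L (IsCMField.complexConj L) v b - b) w) = 1)
    (hx₁ : conjLocal L (IsCMField.complexConj L) v x₁ * x₁ = 1) (hx₂ : conjLocal L (IsCMField.complexConj L) v x₂ * x₂ = 1)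
    (hx₃ : conjLocal L (IsCMField.complexConj L) v x₃ * x₃ = 1) (h₁₂ : x₁ ≠ x₂) (h₂₃ : x₂ ≠ x₃) (h₁₃ : x₁ ≠ x₃)
    (Tl : GL (Fin 3) (LocalRing L v))
    (ψ : ↥(UnitaryGroup.«local» L (IsCMField.complexConj L) 3 H' v) ≃ₜ*
        ↥(UnitaryGroup.«local» L (IsCMField.complexConj L) 3 (Matrix.of fun i j : Fin 3 => if i.val + j.val + 1 = 3 then (1 : L) else 0) v))
    (t : (cmDatum L 3 H').Local v)
    (hψ : ∀ g, (ψ g).val = Tl * g.val * Tl⁻¹)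
    (hlev : ∀ g, g ∈ cmLocalIntegralLevel L 3 H' v ↔
        ψ g ∈ cmLocalIntegralLevel L 3 (Matrix.of fun i j : Fin 3 => if i.val + j.val + 1 = 3 then (1 : L) else 0) v)
    (hlit : (ψ t).val.val =
          !![x₁ * conjLocal L (IsCMField.complexConj L) v b + x₃ * b, 0, x₁ - x₃; 0, x₂, 0;
            b * conjLocal L (IsCMField.complexConj L) v b * (x₁ - x₃), 0, x₁ * b + x₃ * conjLocal L (IsCMField.complexConj L) v b])
    {P Q₁ Q₂ : ℕ} (hP : Valued.v (x₁ w - x₃ w) = WithZero.exp (-(P : ℤ))) (hQ₁ : Valued.v (x₁ w - x₂ w) = WithZero.exp (-(Q₁ : ℤ)))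
    (hQ₂ : Valued.v (x₃ w - x₂ w) = WithZero.exp (-(Q₂ : ℤ)))
    (htri : (Q₁ = Q₂ ∧ Q₁ ≤ P) ∨ (Q₁ = P ∧ Q₁ ≤ Q₂) ∨ (Q₂ = P ∧ Q₂ ≤ Q₁))
    (hd₁ : Valued.v (x₁ w - 1) < 1) (hd₂ : Valued.v (x₂ w - 1) < 1) (hd₃ : Valued.v (x₃ w - 1) < 1)
    -- the θ̄ = 0 INERT COUNT at `L_w` for trace literals: the (C5)′ export head's text at `(L, w)` (CENSUS-C5 bd72510a §3 + T7), a hypothesis until it lands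
    (hX₀ : ∀ {b : w.1.adicCompletion L}, b + galAdicCompletionMap (L := L) (IsCMField.complexConj L) hw b = 1 → Valued.v b ≤ 1 →
      Valued.v (galAdicCompletionMap (L := L) (IsCMField.complexConj L) hw b - b) = 1 →
      ∀ {x₁ x₂ x₃ : w.1.adicCompletion L}, galAdicCompletionMap (L := L) (IsCMField.complexConj L) hw x₁ * x₁ = 1 →
      galAdicCompletionMap (L := L) (IsCMField.complexConj L) hw x₂ * x₂ = 1 → galAdicCompletionMap (L := L) (IsCMField.complexConj L) hw x₃ * x₃ = 1 →
      ∀ {t : ↥(unitaryGroupOfForm (galAdicCompletionMap (L := L) (IsCMField.complexConj L) hw)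
        (placeForm (Matrix.of fun i j : Fin 3 => if i.val + j.val + 1 = 3 then (1 : L) else 0) w.1))},
      ((t : GL (Fin 3) (w.1.adicCompletion L)) : Matrix (Fin 3) (Fin 3) (w.1.adicCompletion L)) =
        !![x₁ * galAdicCompletionMap (L := L) (IsCMField.complexConj L) hw b + x₃ * b, 0, x₁ - x₃; 0, x₂, 0;
          b * galAdicCompletionMap (L := L) (IsCMField.complexConj L) hw b * (x₁ - x₃), 0, x₁ * b + x₃ * galAdicCompletionMap (L := L) (IsCMField.complexConj L) hw b] →
      ∀ {N N₁ N₂ : ℕ}, Valued.v (x₁ - x₃) = WithZero.exp (-(N : ℤ)) → Valued.v (x₁ - x₂) = WithZero.exp (-(N₁ : ℤ)) →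
      Valued.v (x₃ - x₂) = WithZero.exp (-(N₂ : ℤ)) →
      ((N₁ = N₂ ∧ N₁ ≤ N) ∨ (N₁ = N ∧ N₁ ≤ N₂) ∨ (N₂ = N ∧ N₂ ≤ N₁)) →
      {x : ↥(unitaryGroupOfForm (galAdicCompletionMap (L := L) (IsCMField.complexConj L) hw)
          (placeForm (Matrix.of fun i j : Fin 3 => if i.val + j.val + 1 = 3 then (1 : L) else 0) w.1)) ⧸
        unitaryInt (galAdicCompletionMap (L := L) (IsCMField.complexConj L) hw)
          (placeForm (Matrix.of fun i j : Fin 3 => if i.val + j.val + 1 = 3 then (1 : L) else 0) w.1) | t • x = x}.Finite →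
      (Nat.card {x : ↥(unitaryGroupOfForm (galAdicCompletionMap (L := L) (IsCMField.complexConj L) hw)
          (placeForm (Matrix.of fun i j : Fin 3 => if i.val + j.val + 1 = 3 then (1 : L) else 0) w.1)) ⧸
        unitaryInt (galAdicCompletionMap (L := L) (IsCMField.complexConj L) hw)
          (placeForm (Matrix.of fun i j : Fin 3 => if i.val + j.val + 1 = 3 then (1 : L) else 0) w.1) | t • x = x} : ℚ) =
        Flicker1998.phiZero (Ideal.absNorm v.asIdeal) N₁ N₂ N) :
    (({q : (cmDatum L 3 H').Local v ⧸ cmLocalIntegralLevel L 3 H' v |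
        q ∈ MulAction.fixedBy ((cmDatum L 3 H').Local v ⧸ cmLocalIntegralLevel L 3 H' v) t ∧
          (redMat ((((q.out⁻¹ * t * q.out : (cmDatum L 3 H').Local v)).val : GL (Fin 3) (LocalRing L v)).val.map
            (Pi.evalRingHom (fun w' : PlacesOver L v => w'.1.adicCompletion L) w)) - 1).rank = 0}.ncard : ℕ) : ℚ) =
      Flicker1998.phiZero (Ideal.absNorm v.asIdeal) (Q₁ - 1) (Q₂ - 1) (P - 1) := by
  have hc1 : IsCMField.complexConj L ≠ 1 := IsCMField.complexConj_ne_one L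
  haveI : IsAdicComplete (IsLocalRing.maximalIdeal (Valued.integer (w.1.adicCompletion L))) (Valued.integer (w.1.adicCompletion L)) :=
    isAdicComplete_maximalIdeal_valuedInteger_adicCompletion L w.1
  haveI : Algebra.IsQuadraticExtension ↥(maximalRealSubfield L) L := IsCMField.isQuadraticExtension L
  have _h : x₁ ≠ x₂ ∧ x₂ ≠ x₃ ∧ x₁ ≠ x₃ := ⟨h₁₂, h₂₃, h₁₃⟩
  have hσσ : ∀ z : LocalRing L v, conjLocal L (IsCMField.complexConj L) v (conjLocal L (IsCMField.complexConj L) v z) = z :=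
    fun z => conjLocal_conjLocal_cm L v z
  -- the trace frame `Q_b` in the `Φ₃`-model and its Gram matrix `diag(1, 1, −1)`
  obtain ⟨P₁, hP₁, -⟩ := exists_generalLinearGroup_traceFrame (conjLocal L (IsCMField.complexConj L) v) hb
  have hP₁' : P₁.val = !![(1 : LocalRing L v), 0, 1; 0, 1, 0; b, 0, -conjLocal L (IsCMField.complexConj L) v b] := hP₁
  have hG := gram_eq_diagonal_of_traceFrame (conjLocal L (IsCMField.complexConj L) v) hσσ hb P₁ hP₁'
  have hlitP : (ψ t).val.val = P₁.val * diagonal ![x₁, x₂, x₃] * (P₁⁻¹).val := by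
    rw [hlit]; exact traceTorusElt_eq_conj_diagonal_of_frame (conjLocal L (IsCMField.complexConj L) v) hb P₁ hP₁' x₁ x₂ x₃
  obtain ⟨Y₁, Y₂, Y₃, t', hlit', hY₁, hY₂, hY₃, hP', hQ₁', hQ₂', hfin, hn₀⟩ :=
    exists_moebius_literal_of_congr_conj_diagonal L H' hH' hH'u w hw hv hx₁ hx₂ hx₃ Tl ψ t hψ hlev P₁ hG hlitP hP hQ₁ hQ₂ hd₁ hd₂ hd₃
  -- the Möbius literal IS a `t_1^{(b)}`-literal, read at `w`
  have hlit'' : (ψ t').val.val =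
      !![Y₁ * conjLocal L (IsCMField.complexConj L) v b + Y₃ * b, 0, Y₁ - Y₃; 0, Y₂, 0;
        b * conjLocal L (IsCMField.complexConj L) v b * (Y₁ - Y₃), 0, Y₁ * b + Y₃ * conjLocal L (IsCMField.complexConj L) v b] := by
    rw [hlit', traceTorusElt_eq_conj_diagonal_of_frame (conjLocal L (IsCMField.complexConj L) v) hb P₁ hP₁' Y₁ Y₂ Y₃]
  have hσw : ∀ z : LocalRing L v, conjLocal L (IsCMField.complexConj L) v z w = galAdicCompletionMap (L := L) (IsCMField.complexConj L) hw (z w) :=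
    fun z => conjLocal_apply_eq_of_smul_eq (IsCMField.complexConj L) hc1 v w hw z
  have hte : (((localNonsplitEquiv (IsCMField.complexConj L) (Matrix.of fun i j : Fin 3 => if i.val + j.val + 1 = 3 then (1 : L) else 0) hc1 w hw (ψ t') :
        unitaryGroupOfForm (galAdicCompletionMap (L := L) (IsCMField.complexConj L) hw)
          (placeForm (Matrix.of fun i j : Fin 3 => if i.val + j.val + 1 = 3 then (1 : L) else 0) w.1)) :
        GL (Fin 3) (w.1.adicCompletion L)) : Matrix (Fin 3) (Fin 3) (w.1.adicCompletion L)) =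
      !![Y₁ w * conjLocal L (IsCMField.complexConj L) v b w + Y₃ w * b w, 0, Y₁ w - Y₃ w; 0, Y₂ w, 0;
        b w * conjLocal L (IsCMField.complexConj L) v b w * (Y₁ w - Y₃ w), 0, Y₁ w * b w + Y₃ w * conjLocal L (IsCMField.complexConj L) v b w] := by
    rw [coe_coe_localNonsplitEquiv_apply, hlit'']
    ext i j
    fin_cases i <;> fin_cases j <;> rfl
  rw [hσw b] at hte
  -- the data at `w`
  have hbw : b w + galAdicCompletionMap (L := L) (IsCMField.complexConj L) hw (b w) = 1 := by
    have h := congrFun hb w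
    rw [Pi.add_apply, hσw, Pi.one_apply] at h
    exact h
  have hbδw : Valued.v (galAdicCompletionMap (L := L) (IsCMField.complexConj L) hw (b w) - b w) = 1 := by
    have h := hbδ
    rw [Pi.sub_apply, hσw] at h
    exact h
  have h1P := one_le_of_valued_sub_eq_exp_neg hd₁ hd₃ hP
  have h1Q₁ := one_le_of_valued_sub_eq_exp_neg hd₁ hd₂ hQ₁
  have h1Q₂ := one_le_of_valued_sub_eq_exp_neg hd₃ hd₂ hQ₂
  have htri' : (Q₁ - 1 = Q₂ - 1 ∧ Q₁ - 1 ≤ P - 1) ∨ (Q₁ - 1 = P - 1 ∧ Q₁ - 1 ≤ Q₂ - 1) ∨ (Q₂ - 1 = P - 1 ∧ Q₂ - 1 ≤ Q₁ - 1) := by omega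
  rw [hn₀]
  exact hX₀ hbw hbv hbδw hY₁ hY₂ hY₃ hte hP' hQ₁' hQ₂' htri' hfin

end Heads

end Literature.NumberTheory.Rogawski1990

end
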